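import Literature.AnabelianGeometry.EtaleTheta.Discharge.Sec3Cor38iAssembly
import Literature.AlgebraicGeometry.Frobenioids.EquivalencePreStepsFSMFF2008Assembly
import Literature.AnabelianGeometry.EtaleTheta.Discharge.Sec3PhiRIntegralTreeVocab
import HarnessLib

/-!
# [EtTh] Corollary 3.8 (i) — the end-to-end assembly with [FrdI] Thm. 3.4 (ii) DISCHARGED
# (`h34 := FrdI.Thm34ii_holds`)

Mochizuki, *The étale theta function and its Frobenioid-theoretic manifestations*, Publ. RIMS **45** (2009),
Cor. 3.8 (i), PDF pp. 80–81 [cite: MochizukiEtTh2009, Cor 3.8 p.80]: "Suppose, for `i = 1, 2`, that the base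
category `D_i` of `C_i` is Frobenius-slim. Then `Ψ` preserves the base-field-theoretic morphisms."

abc-iut cell, layer L2, node `EtTh:Cor3.8(i)` (seat abc-iut-w6-d039); PROOF-ONLY sequel (0 definitions, two
one-line theorems) of `Sec3Cor38iAssembly.lean`, whose closing theorems `Cor38Hyp.cor38_i_of_thm34ii` /
`cor38_i_treeVocab_of_thm34ii` carry the printed input "[Mzk17], Theorem 3.4, (ii)" as ONE named-fact binder
`h34 : FrdI.Thm34ii` (cell FACT-LIST F-0711) only because the module proving it had no olean on the farm when that
file landed.  Here the binder is instantiated with abc-iut-L1's THEOREM `FrdI.Thm34ii_holds` ([FrdI] Thm. 3.4 (ii)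
in its printed 2008 wording, `EquivalencePreStepsFSMFF2008Assembly`): node `EtTh:Cor3.8(i)` AS TYPED
(`Cor38_i (fun E _ => IsFrobeniusSlim E) h`, abc-iut-L2-t3) then holds GIVEN ONLY `hF_i` ([FrdI] Thm. 5.2 (ii)),
`hstd_i` ([EtTh] Thm. 3.7 (ii)) — resp. `hBmon_i` at the canonical vocabularies — and the four DATA binders per side
of row C38-L05 (cell GAP-LEDGER G-w5d124-1/2/3: `hP34Λ`, `hLine`, `hInt`, `hSup`).
HONEST FRAMING: refereed pre-IUT material; nothing here bears on [IUTchIII] Cor. 3.12; no statement of either paper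
is restated or strengthened.
-/

namespace Literature.AnabelianGeometry.EtaleTheta

open CategoryTheory Opposite Literature.AlgebraicGeometry.Frobenioids

universe u₀ v₀ u v w

section Assembly

variable {D₀ : Type u₀} [Category.{v₀} D₀] {V : FrdIMonoidStub.{w}}
  {T : RealifiedDivisorMonoids (D₀ := D₀) V} {D : Type u} [Category.{v} D] {VD : FrdICatStub.{u, v, w} D}
  {D₀' : Type u₀} [Category.{v₀} D₀'] {T' : RealifiedDivisorMonoids (D₀ := D₀') V}
  {D' : Type u} [Category.{v} D'] {VD' : FrdICatStub.{u, v, w} D'}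
  {C₁ : TemperedFrobenioid T D VD} {C₂ : TemperedFrobenioid T' D' VD'} (h : Cor38Hyp C₁ C₂)

/-- **[EtTh] Corollary 3.8 (i), END TO END, [FrdI] Thm. 3.4 discharged**: for tempered Frobenioids `C₁`, `C₂`
whose model Frobenioids are Frobenioids ([FrdI] Thm. 5.2 (ii), `hF_i`) of standard type ([EtTh] Thm. 3.7 (ii),
`hstd_i`), under `Cor38Hyp` and GIVEN the four printed properties of the Def. 3.3/3.6 (i) data per side, abc-iut-L2-t3's
typed `Cor38_i` holds — every "[Mzk17], Theorem 3.4" input of the printed proof (for `Ψ` and for `Ψ^pf`) being a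
tree theorem (`FrdI.Thm34ii_holds` and its consequences). [cite: MochizukiEtTh2009, Cor 3.8 p.80] -/
theorem Cor38Hyp.cor38_i_of_isOfStandardType (hF₁ : PreFrobenioid.IsFrobenioid C₁.toElem)
    (hF₂ : PreFrobenioid.IsFrobenioid C₂.toElem) (hstd₁ : C₁.opsData.IsOfStandardType)
    (hstd₂ : C₂.opsData.IsOfStandardType)
    (hP34Λ₁ : ∀ (Y : D₀ᵒᵖ) (b : T.BΛ.obj Y) (r : T.ΦR.obj Y),
      T.divΛ Y b = Algebra.GrothendieckGroup.of r → b ∈ T.FΛ Y)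
    (hLine₁ : ∀ (Y : D₀ᵒᵖ) (g : Algebra.GrothendieckGroup (T.ΦR.obj Y)), g ∈ T.cnstR Y →
      ∃ r : T.ΦR.obj Y, g = Algebra.GrothendieckGroup.of r ∨ g = (Algebra.GrothendieckGroup.of r)⁻¹)
    (hInt₁ : ∀ Y : D₀ᵒᵖ, IsCancelMul (T.ΦR.obj Y))
    (hSup₁ : ∀ (W : D) (m : Perfection (C₁.divisorMonoid.obj (op W)))
      (U : Set (Perfection (C₁.divisorMonoid.obj (op W)))),
      U ⊆ C₁.bsFldPf W → U.Nonempty → (∀ u ∈ U, u ∣ m) →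
        ∃ y ∈ C₁.bsFldPf W, (∀ u ∈ U, u ∣ y) ∧ y ∣ m)
    (hP34Λ₂ : ∀ (Y : D₀'ᵒᵖ) (b : T'.BΛ.obj Y) (r : T'.ΦR.obj Y),
      T'.divΛ Y b = Algebra.GrothendieckGroup.of r → b ∈ T'.FΛ Y)
    (hLine₂ : ∀ (Y : D₀'ᵒᵖ) (g : Algebra.GrothendieckGroup (T'.ΦR.obj Y)), g ∈ T'.cnstR Y →
      ∃ r : T'.ΦR.obj Y, g = Algebra.GrothendieckGroup.of r ∨ g = (Algebra.GrothendieckGroup.of r)⁻¹)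
    (hInt₂ : ∀ Y : D₀'ᵒᵖ, IsCancelMul (T'.ΦR.obj Y))
    (hSup₂ : ∀ (W : D') (m : Perfection (C₂.divisorMonoid.obj (op W)))
      (U : Set (Perfection (C₂.divisorMonoid.obj (op W)))),
      U ⊆ C₂.bsFldPf W → U.Nonempty → (∀ u ∈ U, u ∣ m) →
        ∃ y ∈ C₂.bsFldPf W, (∀ u ∈ U, u ∣ y) ∧ y ∣ m) :
    Literature.AnabelianGeometry.EtaleTheta.Cor38_i
      (fun E _ => Literature.AlgebraicGeometry.Frobenioids.IsFrobeniusSlim E) h :=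
  h.cor38_i_of_thm34ii FrdI.Thm34ii_holds hF₁ hF₂ hstd₁ hstd₂ hP34Λ₁ hLine₁ hInt₁ hSup₁ hP34Λ₂ hLine₂ hInt₂ hSup₂

end Assembly

section TreeVocab

variable {D₀ : Type u₀} [Category.{v₀} D₀] {D : Type u} [Category.{v} D]
  {T₁ : RealifiedDivisorMonoids (D₀ := D₀) treeMonoidVocab.{w}}
  {IsRational IsStrictlyRational : (Dᵒᵖ ⥤ CommMonCat.{w}) → Prop}
  {D₀' : Type u₀} [Category.{v₀} D₀'] {T₂ : RealifiedDivisorMonoids (D₀ := D₀') treeMonoidVocab.{w}}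
  {D' : Type u} [Category.{v} D'] {IsRational' IsStrictlyRational' : (D'ᵒᵖ ⥤ CommMonCat.{w}) → Prop}
  {C₁ : TemperedFrobenioid T₁ D (treeCatVocab D IsRational IsStrictlyRational)}
  {C₂ : TemperedFrobenioid T₂ D' (treeCatVocab D' IsRational' IsStrictlyRational')} (h : Cor38Hyp C₁ C₂)

/-- **[EtTh] Corollary 3.8 (i) at the canonical [FrdI] vocabularies, [FrdI] Thm. 3.4 discharged**: inputs
`hBmon_i : IsMonoidOn B_i` ([FrdI] Thm. 5.2 preamble) and the data binders of row C38-L05 ONLY.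
[cite: MochizukiEtTh2009, Cor 3.8 p.80] -/
theorem Cor38Hyp.cor38_i_treeVocab (hBmon₁ : IsMonoidOn C₁.ratFnFunctor) (hBmon₂ : IsMonoidOn C₂.ratFnFunctor)
    (hP34Λ₁ : ∀ (Y : D₀ᵒᵖ) (b : T₁.BΛ.obj Y) (r : T₁.ΦR.obj Y),
      T₁.divΛ Y b = Algebra.GrothendieckGroup.of r → b ∈ T₁.FΛ Y)
    (hLine₁ : ∀ (Y : D₀ᵒᵖ) (g : Algebra.GrothendieckGroup (T₁.ΦR.obj Y)), g ∈ T₁.cnstR Y →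
      ∃ r : T₁.ΦR.obj Y, g = Algebra.GrothendieckGroup.of r ∨ g = (Algebra.GrothendieckGroup.of r)⁻¹)
    (hInt₁ : ∀ Y : D₀ᵒᵖ, IsCancelMul (T₁.ΦR.obj Y))
    (hSup₁ : ∀ (W : D) (m : Perfection (C₁.divisorMonoid.obj (op W)))
      (U : Set (Perfection (C₁.divisorMonoid.obj (op W)))),
      U ⊆ C₁.bsFldPf W → U.Nonempty → (∀ u ∈ U, u ∣ m) →
        ∃ y ∈ C₁.bsFldPf W, (∀ u ∈ U, u ∣ y) ∧ y ∣ m)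
    (hP34Λ₂ : ∀ (Y : D₀'ᵒᵖ) (b : T₂.BΛ.obj Y) (r : T₂.ΦR.obj Y),
      T₂.divΛ Y b = Algebra.GrothendieckGroup.of r → b ∈ T₂.FΛ Y)
    (hLine₂ : ∀ (Y : D₀'ᵒᵖ) (g : Algebra.GrothendieckGroup (T₂.ΦR.obj Y)), g ∈ T₂.cnstR Y →
      ∃ r : T₂.ΦR.obj Y, g = Algebra.GrothendieckGroup.of r ∨ g = (Algebra.GrothendieckGroup.of r)⁻¹)
    (hInt₂ : ∀ Y : D₀'ᵒᵖ, IsCancelMul (T₂.ΦR.obj Y))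
    (hSup₂ : ∀ (W : D') (m : Perfection (C₂.divisorMonoid.obj (op W)))
      (U : Set (Perfection (C₂.divisorMonoid.obj (op W)))),
      U ⊆ C₂.bsFldPf W → U.Nonempty → (∀ u ∈ U, u ∣ m) →
        ∃ y ∈ C₂.bsFldPf W, (∀ u ∈ U, u ∣ y) ∧ y ∣ m) :
    Literature.AnabelianGeometry.EtaleTheta.Cor38_i
      (fun E _ => Literature.AlgebraicGeometry.Frobenioids.IsFrobeniusSlim E) h :=
  h.cor38_i_treeVocab_of_thm34ii FrdI.Thm34ii_holds hBmon₁ hBmon₂ hP34Λ₁ hLine₁ hInt₁ hSup₁ hP34Λ₂ hLine₂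
    hInt₂ hSup₂

end TreeVocab

/-! ### v2 (RQ7 note K3 of abc-iut-w5-d135 on p433112): at the tree's monoid vocabulary `hInt` is a THEOREM -/

section TreeVocabNoInt

variable {D₀ : Type u₀} [Category.{v₀} D₀] {D : Type u} [Category.{v} D]
  {T₁ : RealifiedDivisorMonoids (D₀ := D₀) treeMonoidVocab.{w}}
  {IsRational IsStrictlyRational : (Dᵒᵖ ⥤ CommMonCat.{w}) → Prop}
  {D₀' : Type u₀} [Category.{v₀} D₀'] {T₂ : RealifiedDivisorMonoids (D₀ := D₀') treeMonoidVocab.{w}}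
  {D' : Type u} [Category.{v} D'] {IsRational' IsStrictlyRational' : (D'ᵒᵖ ⥤ CommMonCat.{w}) → Prop}
  {C₁ : TemperedFrobenioid T₁ D (treeCatVocab D IsRational IsStrictlyRational)}
  {C₂ : TemperedFrobenioid T₂ D' (treeCatVocab D' IsRational' IsStrictlyRational')} (h : Cor38Hyp C₁ C₂)

/-- **[EtTh] Corollary 3.8 (i) at the canonical [FrdI] vocabularies, SIX data binders**: at `treeMonoidVocab` the
binder `hInt` ("`Φ₀^ℝ(Y)` is integral") is a tree theorem — `RealifiedDivisorMonoids.hInt_treeMonoidVocab` (field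
`isRealification` + [FrdI] Def. 2.4 (i)(c), `Sec3PhiRIntegralTreeVocab`) — so `Cor38_i` AS TYPED follows from
`hBmon_i : IsMonoidOn B_i` ([FrdI] Thm. 5.2 preamble) and the printed data properties `hP34Λ`, `hLine`, `hSup` per side
(cell GAP-LEDGER G-w5d124-1/2/3) ONLY. [cite: MochizukiEtTh2009, Cor 3.8 p.80] -/
theorem Cor38Hyp.cor38_i_treeVocab_of_data (hBmon₁ : IsMonoidOn C₁.ratFnFunctor)
    (hBmon₂ : IsMonoidOn C₂.ratFnFunctor)
    (hP34Λ₁ : ∀ (Y : D₀ᵒᵖ) (b : T₁.BΛ.obj Y) (r : T₁.ΦR.obj Y),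
      T₁.divΛ Y b = Algebra.GrothendieckGroup.of r → b ∈ T₁.FΛ Y)
    (hLine₁ : ∀ (Y : D₀ᵒᵖ) (g : Algebra.GrothendieckGroup (T₁.ΦR.obj Y)), g ∈ T₁.cnstR Y →
      ∃ r : T₁.ΦR.obj Y, g = Algebra.GrothendieckGroup.of r ∨ g = (Algebra.GrothendieckGroup.of r)⁻¹)
    (hSup₁ : ∀ (W : D) (m : Perfection (C₁.divisorMonoid.obj (op W)))
      (U : Set (Perfection (C₁.divisorMonoid.obj (op W)))),
      U ⊆ C₁.bsFldPf W → U.Nonempty → (∀ u ∈ U, u ∣ m) →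
        ∃ y ∈ C₁.bsFldPf W, (∀ u ∈ U, u ∣ y) ∧ y ∣ m)
    (hP34Λ₂ : ∀ (Y : D₀'ᵒᵖ) (b : T₂.BΛ.obj Y) (r : T₂.ΦR.obj Y),
      T₂.divΛ Y b = Algebra.GrothendieckGroup.of r → b ∈ T₂.FΛ Y)
    (hLine₂ : ∀ (Y : D₀'ᵒᵖ) (g : Algebra.GrothendieckGroup (T₂.ΦR.obj Y)), g ∈ T₂.cnstR Y →
      ∃ r : T₂.ΦR.obj Y, g = Algebra.GrothendieckGroup.of r ∨ g = (Algebra.GrothendieckGroup.of r)⁻¹)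
    (hSup₂ : ∀ (W : D') (m : Perfection (C₂.divisorMonoid.obj (op W)))
      (U : Set (Perfection (C₂.divisorMonoid.obj (op W)))),
      U ⊆ C₂.bsFldPf W → U.Nonempty → (∀ u ∈ U, u ∣ m) →
        ∃ y ∈ C₂.bsFldPf W, (∀ u ∈ U, u ∣ y) ∧ y ∣ m) :
    Literature.AnabelianGeometry.EtaleTheta.Cor38_i
      (fun E _ => Literature.AlgebraicGeometry.Frobenioids.IsFrobeniusSlim E) h :=
  h.cor38_i_treeVocab hBmon₁ hBmon₂ hP34Λ₁ hLine₁ (RealifiedDivisorMonoids.hInt_treeMonoidVocab T₁) hSup₁ hP34Λ₂ hLine₂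
    (RealifiedDivisorMonoids.hInt_treeMonoidVocab T₂) hSup₂

end TreeVocabNoInt

end Literature.AnabelianGeometry.EtaleTheta
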